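/-
Copyright (c) 2026 the pub-hodgecm-mathlib formalisation cell (harness21).  Prover seat hodgecm-mathlib-LH10-p01 (g12): road M6 → F5 → dyadic chain of `stub_DyUnramCore` (D-UNR),
brick (L2-2)-dy «THE LEVEL-TWO FINITE ROOT, 2-FREE» part 2 — transport to any hermitian form, the `𝔽_{q²}` statement; 2026-09-03.
-/
import Literature.GroupTheory.SpecificGroups.FiniteUnitaryThreeNilpotentOrbitsAnyChar   -- ★-to-be (this seat): the split-form classification `exists_unitary_conj_eq_of_lie_antidiag`
import HarnessLib

/-!
# Nilpotent `Ad U₃(𝔽_q)`-orbits by rank, EVERY `q` — any non-degenerate hermitian form (transport from the split form)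

Topic `Literature/GroupTheory/SpecificGroups`; namespace `Literature.GroupTheory.SpecificGroups`.  THEOREMS ONLY (no definition, no named fact, no instance, no notation, no `sorry`);
kernel lane `--supports stmt-HodgeConjecture-24833`.  Cell `pub/hodgecm-mathlib` (D-0151), crux H413 = `stmt-HodgeConjecture-24833`; road M6 → F5 → the dyadic chain of organ (D-UNR)
`stub_DyUnramCore`, LEVEL TWO, site (L2-2): this file finishes the characteristic-free replacement of ★ `exists_unitary_conj_eq_of_pow_three_eq_zero_of_rank_eq … (h2 : (2 : k) ≠ 0)`
(`FiniteUnitaryThreeNilpotentOrbits`, truncated Cayley map) begun in `FiniteUnitaryThreeNilpotentOrbitsAnyChar` (split form `J₀`): `N ↦ T N T⁻¹` carries `Lie U(σ, J)` onto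
`Lie U(σ, J₀)` when `σ(T)ᵀ J₀ T = J` (`θ_{J₀}(TNT⁻¹) = T·θ_J(N)·T⁻¹`), ★ `exists_formCongr_antidiag_eq` supplies `T` over `𝔽_{q²}`, ★ `exists_add_frob_eq_one` the trace-one `θ`,
★ `exists_norm_eq_of_frob` the norms.  HONEST LABEL: HC_CM is proved only modulo the 7 printed citations (2 remaining named inputs: hLiu418 = stmt-HodgeConjecture-24832, h413 =
stmt-HodgeConjecture-24833) until rung 0 closes; elementary, count-neutral (zero label movement until the desk prices the `stub_N6nsDyadic` rider).

* `lie_conj_of_formCongr`; **`exists_unitary_conj_eq_of_pow_three_eq_zero_of_rank_eq_anyChar`** = ★'s statement with `(h2 : (2 : k) ≠ 0)` DELETED — the form the dyadic twin of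
  (L2-2) `interiorStrataConstancy_of_levelTwo` consumes.

## References
* [Rogawski1990] J. D. Rogawski, *Automorphic Representations of Unitary Groups in Three Variables*, Ann. of Math. Stud. 123 (1990): §3.9 p. 32, Proposition 3.9.1.
* [Wilson2009] R. A. Wilson, *The Finite Simple Groups*, GTM 251 (2009): §3.6 (3.25) p. 66, §3.6.1 p. 67.
-/

set_option autoImplicit false

noncomputable section

open Matrix Module Literature.FieldTheory.FiniteFields Literature.NumberTheory.Automorphic
open Literature.NumberTheory.Automorphic.HermitianLattice Literature.NumberTheory.Automorphic.UnitaryGroup Literature.LinearAlgebra.Matrix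

namespace Literature.GroupTheory.SpecificGroups

section Transport

variable {K : Type*} [Field K] (σ : K →+* K)

/-- **`N ↦ T N T⁻¹` carries `Lie U(σ, J)` to `Lie U(σ, J₀)` when `σ(T)ᵀ J₀ T = J`**: `θ_{J₀}(TNT⁻¹) = T·θ_J(N)·T⁻¹` (`σ(T)ᵀJ₀ = JT⁻¹`, `J₀⁻¹σ(T⁻¹)ᵀ = TJ⁻¹`).
[cite: Rogawski1990, §3.9 p. 32] [cite: Wilson2009, §3.6 (3.25) p. 66] -/
theorem lie_conj_of_formCongr {J : Matrix (Fin 3) (Fin 3) K} (hdet : J.det ≠ 0) {T : GL (Fin 3) K}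
    (hT : formCongr σ T ((StdForm.antidiagonal 3).over K) = J) {N : Matrix (Fin 3) (Fin 3) K} (hN : J⁻¹ * (N.map σ)ᵀ * J = -N) :
    ((StdForm.antidiagonal 3).over K)⁻¹ * (((T : Matrix (Fin 3) (Fin 3) K) * N * ((T⁻¹ : GL (Fin 3) K) : Matrix (Fin 3) (Fin 3) K)).map σ)ᵀ *
        (StdForm.antidiagonal 3).over K =
      -((T : Matrix (Fin 3) (Fin 3) K) * N * ((T⁻¹ : GL (Fin 3) K) : Matrix (Fin 3) (Fin 3) K)) := by
  have hJu : IsUnit J.det := isUnit_iff_ne_zero.2 hdet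
  set J₀ : Matrix (Fin 3) (Fin 3) K := (StdForm.antidiagonal 3).over K with hJ₀
  have hTT : (T : Matrix (Fin 3) (Fin 3) K) * ((T⁻¹ : GL (Fin 3) K) : Matrix (Fin 3) (Fin 3) K) = 1 := by
    rw [← Units.val_mul, mul_inv_cancel, Units.val_one]
  have hTT' : ((T⁻¹ : GL (Fin 3) K) : Matrix (Fin 3) (Fin 3) K) * (T : Matrix (Fin 3) (Fin 3) K) = 1 := by
    rw [← Units.val_mul, inv_mul_cancel, Units.val_one]
  have hσTT' : (((T⁻¹ : GL (Fin 3) K) : Matrix (Fin 3) (Fin 3) K).map σ)ᵀ * ((T : Matrix (Fin 3) (Fin 3) K).map σ)ᵀ = 1 := by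
    rw [← Matrix.transpose_mul, ← Matrix.map_mul, hTT, Matrix.map_one σ (map_zero σ) (map_one σ), Matrix.transpose_one]
  -- `σ(T)ᵀ J₀ = J T⁻¹` and `J₀⁻¹ σ(T⁻¹)ᵀ = T J⁻¹`
  have h1 : ((T : Matrix (Fin 3) (Fin 3) K).map σ)ᵀ * J₀ = J * ((T⁻¹ : GL (Fin 3) K) : Matrix (Fin 3) (Fin 3) K) := by
    rw [← hT]
    change _ = ((T : Matrix (Fin 3) (Fin 3) K).map σ)ᵀ * J₀ * (T : Matrix (Fin 3) (Fin 3) K) * ((T⁻¹ : GL (Fin 3) K) : Matrix (Fin 3) (Fin 3) K)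
    rw [Matrix.mul_assoc (((T : Matrix (Fin 3) (Fin 3) K).map σ)ᵀ * J₀), hTT, Matrix.mul_one]
  have h2 : J₀⁻¹ * (((T⁻¹ : GL (Fin 3) K) : Matrix (Fin 3) (Fin 3) K).map σ)ᵀ = (T : Matrix (Fin 3) (Fin 3) K) * J⁻¹ := by
    have hJ₀u : IsUnit J₀.det := (Matrix.isUnit_iff_isUnit_det _).1 ((StdForm.antidiagonal 3).isUnit_over K)
    have h2a : J₀⁻¹ * (((T⁻¹ : GL (Fin 3) K) : Matrix (Fin 3) (Fin 3) K).map σ)ᵀ * J = (T : Matrix (Fin 3) (Fin 3) K) := by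
      calc J₀⁻¹ * (((T⁻¹ : GL (Fin 3) K) : Matrix (Fin 3) (Fin 3) K).map σ)ᵀ * J
          = J₀⁻¹ * (((T⁻¹ : GL (Fin 3) K) : Matrix (Fin 3) (Fin 3) K).map σ)ᵀ * (J * ((T⁻¹ : GL (Fin 3) K) : Matrix (Fin 3) (Fin 3) K)) *
              (T : Matrix (Fin 3) (Fin 3) K) := by
            rw [Matrix.mul_assoc (J₀⁻¹ * (((T⁻¹ : GL (Fin 3) K) : Matrix (Fin 3) (Fin 3) K).map σ)ᵀ), Matrix.mul_assoc J, hTT', Matrix.mul_one]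
        _ = J₀⁻¹ * ((((T⁻¹ : GL (Fin 3) K) : Matrix (Fin 3) (Fin 3) K).map σ)ᵀ * ((T : Matrix (Fin 3) (Fin 3) K).map σ)ᵀ) * J₀ * (T : Matrix (Fin 3) (Fin 3) K) := by
            rw [← h1]; simp only [Matrix.mul_assoc]
        _ = (T : Matrix (Fin 3) (Fin 3) K) := by rw [hσTT', Matrix.mul_one, Matrix.nonsing_inv_mul J₀ hJ₀u, Matrix.one_mul]
    calc J₀⁻¹ * (((T⁻¹ : GL (Fin 3) K) : Matrix (Fin 3) (Fin 3) K).map σ)ᵀ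
        = J₀⁻¹ * (((T⁻¹ : GL (Fin 3) K) : Matrix (Fin 3) (Fin 3) K).map σ)ᵀ * (J * J⁻¹) := by rw [Matrix.mul_nonsing_inv J hJu, Matrix.mul_one]
      _ = J₀⁻¹ * (((T⁻¹ : GL (Fin 3) K) : Matrix (Fin 3) (Fin 3) K).map σ)ᵀ * J * J⁻¹ := by simp only [Matrix.mul_assoc]
      _ = (T : Matrix (Fin 3) (Fin 3) K) * J⁻¹ := by rw [h2a]
  -- assemble
  calc J₀⁻¹ * (((T : Matrix (Fin 3) (Fin 3) K) * N * ((T⁻¹ : GL (Fin 3) K) : Matrix (Fin 3) (Fin 3) K)).map σ)ᵀ * J₀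
      = J₀⁻¹ * (((T⁻¹ : GL (Fin 3) K) : Matrix (Fin 3) (Fin 3) K).map σ)ᵀ * (N.map σ)ᵀ * (((T : Matrix (Fin 3) (Fin 3) K).map σ)ᵀ * J₀) := by
        rw [Matrix.map_mul, Matrix.map_mul, Matrix.transpose_mul, Matrix.transpose_mul]
        simp only [Matrix.mul_assoc]
    _ = (T : Matrix (Fin 3) (Fin 3) K) * (J⁻¹ * (N.map σ)ᵀ * J) * ((T⁻¹ : GL (Fin 3) K) : Matrix (Fin 3) (Fin 3) K) := by
        rw [h1, ← Matrix.mul_assoc, ← Matrix.mul_assoc, h2]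
        simp only [Matrix.mul_assoc]
    _ = -((T : Matrix (Fin 3) (Fin 3) K) * N * ((T⁻¹ : GL (Fin 3) K) : Matrix (Fin 3) (Fin 3) K)) := by
        rw [hN, Matrix.mul_neg, Matrix.neg_mul]

end Transport

section Finite

variable {K : Type*} [Field K] [Fintype K] {q : ℕ}

/-- **NILPOTENT `Ad U₃(𝔽_q)`-ORBITS ARE CLASSIFIED BY THE RANK — EVERY `q`** (= ★ `exists_unitary_conj_eq_of_pow_three_eq_zero_of_rank_eq` with the binder `(h2 : (2 : k) ≠ 0)`
DELETED): `N, N′ ∈ Lie U(σ, J)` (`J⁻¹σ(N)ᵀJ = −N`, `J ∈ M₃(𝔽_{q²})` non-degenerate `σ`-hermitian, `σ = Frob_q`), `N³ = N′³ = 0`, `rank N = rank N′` ⇒ `gNg⁻¹ = N′` for some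
`g ∈ U(σ, J)`.  Transport to `J₀` (★ `exists_formCongr_antidiag_eq`, `lie_conj_of_formCongr`) and §4 with `θ` from ★ `exists_add_frob_eq_one` and norms from ★ `exists_norm_eq_of_frob`.
[cite: Rogawski1990, §3.9 p. 32, Prop. 3.9.1] [cite: Wilson2009, §3.6.1 p. 67] -/
theorem exists_unitary_conj_eq_of_pow_three_eq_zero_of_rank_eq_anyChar (hk : Fintype.card K = q ^ 2) (σ : K →+* K) (hσq : ∀ x, σ x = x ^ q)
    {J : Matrix (Fin 3) (Fin 3) K} (hJ : (J.map σ)ᵀ = J) (hdet : J.det ≠ 0)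
    {N N' : Matrix (Fin 3) (Fin 3) K} (hN : J⁻¹ * (N.map σ)ᵀ * J = -N) (hN' : J⁻¹ * (N'.map σ)ᵀ * J = -N')
    (hnil : N ^ 3 = 0) (hnil' : N' ^ 3 = 0) (hrank : N.rank = N'.rank) :
    ∃ g : GL (Fin 3) K, g ∈ unitaryGroupOfForm σ J ∧ (g : Matrix (Fin 3) (Fin 3) K) * N * ((g⁻¹ : GL (Fin 3) K) : Matrix (Fin 3) (Fin 3) K) = N' := by
  have hσ := frob_frob hk σ hσq
  obtain ⟨θ, hθ⟩ := exists_add_frob_eq_one hk σ hσq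
  have hnorm : ∀ e : K, σ e = e → e ≠ 0 → ∃ z : K, σ z * z = e := fun e he he0 => exists_norm_eq_of_frob hk σ hσq he he0
  have hN3 : N * N * N = 0 := by rw [← hnil, pow_succ, pow_two]
  have hN3' : N' * N' * N' = 0 := by rw [← hnil', pow_succ, pow_two]
  obtain ⟨T, hT⟩ := exists_formCongr_antidiag_eq hk σ hσq J hJ hdet
  -- move to `Lie U(σ, J₀)` by `X ↦ T X T⁻¹`
  set M : Matrix (Fin 3) (Fin 3) K := (T : Matrix (Fin 3) (Fin 3) K) * N * ((T⁻¹ : GL (Fin 3) K) : Matrix (Fin 3) (Fin 3) K) with hM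
  set M' : Matrix (Fin 3) (Fin 3) K := (T : Matrix (Fin 3) (Fin 3) K) * N' * ((T⁻¹ : GL (Fin 3) K) : Matrix (Fin 3) (Fin 3) K) with hM'
  have hMlie := lie_conj_of_formCongr σ hdet hT hN
  have hMlie' := lie_conj_of_formCongr σ hdet hT hN'
  have hcube : ∀ X : Matrix (Fin 3) (Fin 3) K, X * X * X = 0 →
      (T : Matrix (Fin 3) (Fin 3) K) * X * ((T⁻¹ : GL (Fin 3) K) : Matrix (Fin 3) (Fin 3) K) * ((T : Matrix (Fin 3) (Fin 3) K) * X * ((T⁻¹ : GL (Fin 3) K) : Matrix (Fin 3) (Fin 3) K)) *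
        ((T : Matrix (Fin 3) (Fin 3) K) * X * ((T⁻¹ : GL (Fin 3) K) : Matrix (Fin 3) (Fin 3) K)) = 0 := by
    intro X hX
    have e : (T : Matrix (Fin 3) (Fin 3) K) * X * ((T⁻¹ : GL (Fin 3) K) : Matrix (Fin 3) (Fin 3) K) * ((T : Matrix (Fin 3) (Fin 3) K) * X * ((T⁻¹ : GL (Fin 3) K) : Matrix (Fin 3) (Fin 3) K)) *
        ((T : Matrix (Fin 3) (Fin 3) K) * X * ((T⁻¹ : GL (Fin 3) K) : Matrix (Fin 3) (Fin 3) K)) =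
        (T : Matrix (Fin 3) (Fin 3) K) * (X * X * X) * ((T⁻¹ : GL (Fin 3) K) : Matrix (Fin 3) (Fin 3) K) := by
      simp only [Matrix.mul_assoc, Units.inv_mul_cancel_left]
    rw [e, hX, Matrix.mul_zero, Matrix.zero_mul]
  have hTdet : IsUnit (T : Matrix (Fin 3) (Fin 3) K).det := Matrix.isUnits_det_units T
  have hTidet : IsUnit ((T⁻¹ : GL (Fin 3) K) : Matrix (Fin 3) (Fin 3) K).det := Matrix.isUnits_det_units T⁻¹
  have hrankM : M.rank = M'.rank := by
    rw [hM, hM', Matrix.rank_mul_eq_left_of_isUnit_det _ _ hTidet, Matrix.rank_mul_eq_left_of_isUnit_det _ _ hTidet,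
      Matrix.rank_mul_eq_right_of_isUnit_det _ _ hTdet, Matrix.rank_mul_eq_right_of_isUnit_det _ _ hTdet, hrank]
  obtain ⟨g₀, hg₀, hconj⟩ := exists_unitary_conj_eq_of_lie_antidiag σ hσ hθ hnorm hMlie hMlie' (hcube N hN3) (hcube N' hN3') hrankM
  -- back: `g := T⁻¹ g₀ T ∈ U(σ, J)`
  refine ⟨T⁻¹ * g₀ * T, ?_, ?_⟩
  · have key := (conj_mem_unitaryGroupOfForm_iff σ T ((StdForm.antidiagonal 3).over K) (T⁻¹ * g₀ * T)).1
    rw [hT] at key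
    apply key
    have hg : T * (T⁻¹ * g₀ * T) * T⁻¹ = g₀ := by group
    rw [hg]
    exact hg₀
  · have e : N' = ((T⁻¹ : GL (Fin 3) K) : Matrix (Fin 3) (Fin 3) K) * M' * (T : Matrix (Fin 3) (Fin 3) K) := by
      rw [hM']; simp only [Matrix.mul_assoc, Units.inv_mul_cancel_left, Units.inv_mul, Matrix.mul_one]
    rw [e, hM', ← hconj]
    simp only [Units.val_mul, _root_.mul_inv_rev, inv_inv, Matrix.mul_assoc]

end Finite

end Literature.GroupTheory.SpecificGroups

end
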